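import Summits.CriticalPhenomena.CardyFormulaZ2.Theorems.CardyFlipRussoVoronoiHubFromSmirnovGraphDefs

/-!
# Stub `far_attachment` of line `moebius-exact-delaunay-dilation-ward`
# (crux `VoronoiHubFromSmirnov`, stmt-CriticalPhenomena-6433) — one-arm route, far attachment

In the one-arm route a square whose whitening destroys a black chain crossing between the
attachments of the arcs `(ab) = R.arc 0` and `(cd) = R.arc 2` must carry a chain arm reaching the
FARTHER attachment.  This file proves the deterministic geometric input: there is `D₀ > 0` such
that, eventually as `δ → 0⁺`, every configuration point `z` is at configuration distance `> D₀/δ`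
from (the pull-back `{x | δ x ∈ A δ}` of) at least one of the two attachment sets `A₀ δ`, `A₂ δ`.

Proof.  The opposite arcs `R.arc 0`, `R.arc 2` are disjoint compact sets, hence at positive
distance `m` (`MarkedDomain.exists_pos_forall_lt_dist_arc`, Literature).  Put `D₀ = m / 5`.
Eventually `A_i δ ⊆ thickening (b_i √δ) (R.arc i)` with `b_i √δ < D₀` and `0 < δ`.  If some `x₀`
with `δ x₀ ∈ A₀ δ` has `dist x₀ z ≤ D₀/δ`, then for every `y` with `δ y ∈ A₂ δ` the physical
points `δ x₀`, `δ y` are within `D₀` of the two arcs, so `δ · dist x₀ y ≥ m - 2 D₀ = 3 D₀`, whence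
`δ · dist y z ≥ 3 D₀ - D₀ > D₀`.  All [folklore].
-/

noncomputable section

namespace Summit.CriticalPhenomena.CardyFormulaZ2.Cruxes.VoronoiHubFromSmirnov.MoebiusExactDelaunayDilationWard

open scoped Topology
open Filter Set Metric Literature.Probability.RandomPlanarGeometry

/-- **Far attachment.**  For admissible attachment families `A₀`, `A₂` of the opposite arcs
`R.arc 0`, `R.arc 2` of a conformal rectangle there is `D₀ > 0` such that, eventually as
`δ → 0⁺`, every point `z` is at configuration distance `> D₀/δ` from all `x` with `δ x ∈ A₀ δ`
or from all `x` with `δ x ∈ A₂ δ` (the arcs are at positive distance and the attachments shrink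
onto them). [folklore] -/
theorem far_attachment : ∀ (R : Literature.Probability.RandomPlanarGeometry.ConformalRectangle) (A₀ A₂ : ℝ → Set ℂ), IsAttachment R 0 A₀ → IsAttachment R 2 A₂ → ∃ D₀ : ℝ, 0 < D₀ ∧ ∀ᶠ δ : ℝ in nhdsWithin 0 (Set.Ioi 0), ∀ z : ℂ, (∀ x : ℂ, (δ : ℂ) * x ∈ A₀ δ → D₀ / δ < dist x z) ∨ (∀ x : ℂ, (δ : ℂ) * x ∈ A₂ δ → D₀ / δ < dist x z) := by
  intro R A₀ A₂ hA₀ hA₂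
  -- positive separation of the opposite arcs
  obtain ⟨m, hm, hsep⟩ := R.exists_pos_forall_lt_dist_arc
  obtain ⟨a₀, b₀, -, -, hev₀⟩ := hA₀
  obtain ⟨a₂, b₂, -, -, hev₂⟩ := hA₂
  have hD : 0 < m / 5 := by positivity
  -- the attachment collars shrink: eventually `max b₀ b₂ · √δ < m / 5`
  have hsqrt : ∀ᶠ δ : ℝ in 𝓝[>] 0, max b₀ b₂ * Real.sqrt δ < m / 5 := by
    have h1 : Tendsto (fun δ : ℝ => max b₀ b₂ * Real.sqrt δ) (𝓝 0)
        (𝓝 (max b₀ b₂ * Real.sqrt 0)) :=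
      (continuous_const.mul Real.continuous_sqrt).tendsto 0
    rw [Real.sqrt_zero, mul_zero] at h1
    exact (h1.mono_left nhdsWithin_le_nhds).eventually (eventually_lt_nhds hD)
  refine ⟨m / 5, hD, ?_⟩
  filter_upwards [hev₀, hev₂, hsqrt, self_mem_nhdsWithin] with δ h₀ h₂ hb hδ
  rw [mem_Ioi] at hδ
  have hb₀ : b₀ * Real.sqrt δ < m / 5 :=
    (mul_le_mul_of_nonneg_right (le_max_left _ _) (Real.sqrt_nonneg δ)).trans_lt hb
  have hb₂ : b₂ * Real.sqrt δ < m / 5 :=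
    (mul_le_mul_of_nonneg_right (le_max_right _ _) (Real.sqrt_nonneg δ)).trans_lt hb
  intro z
  by_cases hfar : ∀ x : ℂ, (δ : ℂ) * x ∈ A₀ δ → m / 5 / δ < dist x z
  · exact Or.inl hfar
  · right
    push Not at hfar
    obtain ⟨x₀, hx₀, hx₀z⟩ := hfar
    intro y hy
    -- nearby arc points of the physical positions `δ x₀ ∈ A₀ δ`, `δ y ∈ A₂ δ`
    obtain ⟨x', hx', hdx⟩ := mem_thickening_iff.1 (h₀.2.2 hx₀)
    obtain ⟨y', hy', hdy⟩ := mem_thickening_iff.1 (h₂.2.2 hy)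
    have hm' : m < dist x' y' := hsep x' hx' y' hy'
    have htri : dist x' y' ≤
        dist ((δ : ℂ) * x₀) x' + dist ((δ : ℂ) * x₀) ((δ : ℂ) * y) + dist ((δ : ℂ) * y) y' := by
      have := dist_triangle4 x' ((δ : ℂ) * x₀) ((δ : ℂ) * y) y'
      rwa [dist_comm x' ((δ : ℂ) * x₀)] at this
    -- dilation by `δ > 0` multiplies distances by `δ`
    have hscale : dist ((δ : ℂ) * x₀) ((δ : ℂ) * y) = δ * dist x₀ y := by
      rw [dist_eq_norm, dist_eq_norm, ← mul_sub, norm_mul, Complex.norm_real, Real.norm_eq_abs,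
        abs_of_pos hδ]
    rw [hscale] at htri
    have htri2 : δ * dist x₀ y ≤ δ * dist x₀ z + δ * dist y z := by
      rw [← mul_add]
      exact mul_le_mul_of_nonneg_left (dist_triangle_right x₀ y z) hδ.le
    have hxz : dist x₀ z * δ ≤ m / 5 := (le_div_iff₀ hδ).1 hx₀z
    rw [div_lt_iff₀ hδ]
    nlinarith [dist_nonneg (x := y) (y := z)]

end Summit.CriticalPhenomena.CardyFormulaZ2.Cruxes.VoronoiHubFromSmirnov.MoebiusExactDelaunayDilationWard

end
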